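import Literature.IUT.HodgeTheaters.ThetaHodgeTheatersCor56iSub
import HarnessLib

/-!
# [IUTchI] Corollary 5.6 (i), sub-DAG rows L02/L03 reduced to structural laws of the kit (proof-only companion)

S. Mochizuki, *Inter-universal Teichmüller theory I*, kurims manuscript (May 2020), §5, Corollary 5.6 (i), proof
p. 154 l. 8–24; Remark 5.2.1 (ii) p. 143 ([IUTchI] Cor 5.6 (i) p.154) [claim: Mochizuki2012, status: disputed].
Proof-only companion (abc-iut cell, seat abc-iut-w5-d217; 0 definitions, no new named `Prop`) of the sub-DAG file
`ThetaHodgeTheatersCor56iSub.lean` (p414027, rows C56i/L01–L06 of plan/L5/SUBDAG-IUTchI-Cor56i.md over abc-iut-L5-t4's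
kit `PMBaseKit.FKit`).  That file PROVED the assembly `cor56iKit_of : L02 → Cor 5.3 (ii) → Cor 5.3 (iv) → L03 → Cor 5.6 (i)`
and the tightness `cor56iKit_iff_rlfDetermined`, leaving exactly two [IUTchI]-internal rows for the real kit: L02
`ThToFBijOnGood` ("for `v ∈ 𝕍^good`, … `†ℱ_{>,v} = †ℱ̲_v`", p. 154 l. 13–16) and L03 `RlfDetermined` ("this global data
may be obtained by applying the functorial algorithm "`‡𝔉 ↦ ‡𝔉^⊩`" … to the associated `ℱ`-prime-strips", p. 154
l. 16–20).  HERE each row is reduced to STRUCTURAL LAWS of the kit — laws the intended model of Examples 3.2–3.5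
satisfies by construction (the kit `FKit` records the data of Rmk 5.2.1 (ii) but, being an interface, not these
laws), so that the real-kit discharge of Cor 5.6 (i) becomes a checklist:

* `thToFBijOnGood_of_fullyFaithful` — L02 holds as soon as the functor `thToF v` (local datum of Def 3.6 ↦
  `ℱ`-prime-strip datum of Def 5.2 (i)) is fully faithful at `v ∉ 𝕍^bad`; in the intended model it is the identity.
* `rlfIsoFaithful_of_faithful` — L03a holds as soon as the family `{rlfFm v}_v` (`‡𝔉^⊩ ↦` its `ℱ^⊢`-prime-strip,
  Def 5.2 (iv) (d)) is jointly faithful on isomorphisms ("rigidity of the divisor monoids", Rmk 5.2.1 (ii) p. 143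
  l. 19–22 — the category-level form of abc-iut-w4-d009's `InitialThetaData.phiMod_addEquiv_eq_refl_of_rho_compat`).
* `rlfIsoLifts_of_functorialAlgorithm` — L03b holds as soon as (i) the global realified datum `†𝔉^⊩_mod` of every
  Θ-Hodge theater is identified with the output `(†𝔉_>)^⊩ = FK.rlfOf †𝔉_>` of the functorial algorithm of Rmk 5.2.1
  (ii) COMPATIBLY with the identifications `rlf_fm` (Def 3.6 (c)) and `rlfFm_rlfOf` (Rmk 5.2.1 (ii)), and (ii) the
  kit isomorphism `rlfFm_rlfOf : ((‡𝔉)^⊩)^⊢_v ≅ (‡ℱ_v)^⊢` is NATURAL in isomorphisms of `ℱ`-prime-strips w.r.t.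
  `rlfOfMap` (functoriality of "`‡𝔉 ↦ ‡𝔉^⊩`") — then the global component of an isomorphism of Θ-Hodge theaters is
  `canon₁ ≫ rlfOfMap (†𝔉_> ⥲ ‡𝔉_>) ≫ canon₂⁻¹`; this is the printed sentence p. 154 l. 16–20 made explicit.
* `rlfDetermined_of_laws`, `cor56iKit_of_laws` — hence L03, and Cor 5.6 (i) over the kit from Cor 5.3 (ii), (iv) BY
  NAME plus the three structural laws (all hypotheses inline; nothing asserted).

Typed ≠ proved for the real kit (TODO-merge:abc-iut-L5-t2 Examples 3.2–3.5); no side is taken on [IUTchIII] Cor 3.12.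
-/

namespace Literature.IUT.HodgeTheaters

open CategoryTheory

universe u

namespace PMBaseKit

namespace FKit

noncomputable section

variable {l : ℕ} {K : PMBaseKit.{u} l} {M : K.MultKit} {FK : K.FKit M}

/-! ### Row L02 from full faithfulness of `thToF v` at good places -/

/-- **C56i/L02 ⇐ `thToF v` fully faithful at `v ∉ 𝕍^bad`** (p. 154 l. 13–16: "for `v ∈ 𝕍^good`, one verifies
immediately that `†ℱ_{>,v} = †ℱ̲_v`" — in the intended model the functor is the identity): a fully faithful functor is
bijective on isomorphisms. PROVED. ([IUTchI] Cor 5.6 (i) p.154) [claim: Mochizuki2012, status: disputed] -/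
theorem thToFBijOnGood_of_fullyFaithful (h : ∀ v, v ∉ K.bad → (FK.thToF v).FullyFaithful) :
    FK.ThToFBijOnGood := fun v hv =>
  (h v hv).isoEquiv.bijective

/-! ### Row L03a from joint faithfulness of the `ℱ^⊢`-components -/

/-- **C56i/L03a ⇐ joint faithfulness of `{rlfFm v}_v` on isomorphisms** (Rmk 5.2.1 (ii) p. 143 l. 19–22: "it follows
immediately … from the rigidity of the divisor monoids associated to the Frobenioids that appear at each of the
components at `v ∈ 𝕍` of an `ℱ`-prime-strip …"): if an isomorphism between globally realified data is determined by its
`ℱ^⊢`-prime-strip components, then in particular so is the global component of an isomorphism of Θ-Hodge theaters.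
PROVED (restriction of the law to the global data of Θ-Hodge theaters). ([IUTchI] Rmk 5.2.1 (ii) p.143) [claim: Mochizuki2012, status: disputed] -/
theorem rlfIsoFaithful_of_faithful
    (h : ∀ (R₁ R₂ : FK.RlfAmb) (a b : R₁ ≅ R₂),
      (∀ v, (FK.rlfFm v).map a.hom = (FK.rlfFm v).map b.hom) → a = b) :
    FK.RlfIsoFaithful := fun H₁ H₂ a b hab =>
  h H₁.rlf H₂.rlf a b hab

/-! ### Row L03b from the functorial algorithm `‡𝔉 ↦ ‡𝔉^⊩` of Rmk 5.2.1 (ii) -/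

/-- **C56i/L03b ⇐ the functorial algorithm, made explicit** (p. 154 l. 16–20: "one verifies immediately that this
global data may be obtained by applying the functorial algorithm "`‡𝔉 ↦ ‡𝔉^⊩`" summarized in the second display of
Remark 5.2.1, (ii), to the associated `ℱ`-prime-strips that appear").  Hypotheses (all inline): (`canon`, `hcanon`)
for every Θ-Hodge theater `H`, an identification `H.rlf ≅ FK.rlfOf H.fStrip.obj` of its global realified datum with the
output of the algorithm on `†𝔉_>`, compatible at each `v` with `rlf_fm` (Def 3.6 (c)) and `rlfFm_rlfOf` (Rmk 5.2.1
(ii)); (`hnat`) naturality of `rlfFm_rlfOf` in isomorphisms of `ℱ`-prime-strips w.r.t. `rlfOfMap`.  Conclusion: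
every family `t` of local isomorphisms has the compatible global component
`canon₁ ≫ rlfOfMap (thIsoToF t) ≫ canon₂⁻¹` — row L03b `RlfIsoLifts`. PROVED.
([IUTchI] Cor 5.6 (i) p.154) [claim: Mochizuki2012, status: disputed] -/
theorem rlfIsoLifts_of_functorialAlgorithm
    (canon : ∀ H : FK.ThetaHT, H.rlf ≅ FK.rlfOf fun v => (FK.thToF v).obj (H.th v))
    (hcanon : ∀ (H : FK.ThetaHT) (v : K.V),
      (FK.rlfFm v).map (canon H).hom ≫ (FK.rlfFm_rlfOf (fun w => (FK.thToF w).obj (H.th w)) v).hom =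
        (H.rlf_fm v).hom)
    (hnat : ∀ (F₁ F₂ : ∀ v, FK.FAmb v) (f : ∀ v, F₁ v ≅ F₂ v) (v : K.V),
      (FK.rlfFm v).map (FK.rlfOfMap f).hom ≫ (FK.rlfFm_rlfOf F₂ v).hom =
        (FK.rlfFm_rlfOf F₁ v).hom ≫ (FK.toFm v).map (f v).hom) :
    FK.RlfIsoLifts := by
  intro H₁ H₂ t
  refine ⟨canon H₁ ≪≫ FK.rlfOfMap (fun w => (FK.thToF w).mapIso (t w)) ≪≫ (canon H₂).symm, fun v => ?_⟩
  have h2 : (FK.rlfFm v).map (canon H₂).inv ≫ (H₂.rlf_fm v).hom =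
      (FK.rlfFm_rlfOf (fun w => (FK.thToF w).obj (H₂.th w)) v).hom :=
    ((FK.rlfFm v).mapIso (canon H₂)).inv_comp_eq.mpr (hcanon H₂ v).symm
  have h3 := hnat (fun w => (FK.thToF w).obj (H₁.th w)) (fun w => (FK.thToF w).obj (H₂.th w))
    (fun w => (FK.thToF w).mapIso (t w)) v
  show (FK.rlfFm v).map
      (canon H₁ ≪≫ FK.rlfOfMap (fun w => (FK.thToF w).mapIso (t w)) ≪≫ (canon H₂).symm).hom ≫
      (H₂.rlf_fm v).hom = (H₁.rlf_fm v).hom ≫ (FK.toFm v).map ((FK.thToF v).map (t v).hom)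
  rw [Iso.trans_hom, Iso.trans_hom, Iso.symm_hom, Functor.map_comp, Functor.map_comp, Category.assoc,
    Category.assoc, h2, h3, ← Category.assoc, hcanon H₁ v]
  rfl

/-- **C56i/L03 from the structural laws**: joint faithfulness of the `ℱ^⊢`-components (L03a) and the functorial
algorithm with its canonical identification (L03b) give the row of record `RlfDetermined` (`∃!`). PROVED.
([IUTchI] Cor 5.6 (i) p.154) [claim: Mochizuki2012, status: disputed] -/
theorem rlfDetermined_of_laws
    (hfaith : ∀ (R₁ R₂ : FK.RlfAmb) (a b : R₁ ≅ R₂),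
      (∀ v, (FK.rlfFm v).map a.hom = (FK.rlfFm v).map b.hom) → a = b)
    (canon : ∀ H : FK.ThetaHT, H.rlf ≅ FK.rlfOf fun v => (FK.thToF v).obj (H.th v))
    (hcanon : ∀ (H : FK.ThetaHT) (v : K.V),
      (FK.rlfFm v).map (canon H).hom ≫ (FK.rlfFm_rlfOf (fun w => (FK.thToF w).obj (H.th w)) v).hom =
        (H.rlf_fm v).hom)
    (hnat : ∀ (F₁ F₂ : ∀ v, FK.FAmb v) (f : ∀ v, F₁ v ≅ F₂ v) (v : K.V),
      (FK.rlfFm v).map (FK.rlfOfMap f).hom ≫ (FK.rlfFm_rlfOf F₂ v).hom =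
        (FK.rlfFm_rlfOf F₁ v).hom ≫ (FK.toFm v).map (f v).hom) :
    FK.RlfDetermined :=
  rlfDetermined_of (rlfIsoFaithful_of_faithful hfaith) (rlfIsoLifts_of_functorialAlgorithm canon hcanon hnat)

/-! ### Cor 5.6 (i) over the kit: the real-kit discharge checklist -/

/-- **[IUTchI] Cor 5.6 (i) over the kit — discharge checklist** (proof p. 154 l. 8–24): Cor 5.6 (i) (`Cor56iKit`)
follows from Cor 5.3 (ii) (`IsomFtoDBijective`) and Cor 5.3 (iv) (`AutTemperedBijective`) BY NAME together with three
structural laws of the kit — `thToF v` fully faithful at good `v` (L02), `{rlfFm v}_v` jointly faithful on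
isomorphisms (L03a), and the functorial algorithm `‡𝔉 ↦ ‡𝔉^⊩` with its compatible canonical identification and
naturality (L03b).  PROVED; every hypothesis inline; CONDITIONAL on the two Cor 5.3 statements (nodes
IUTchI:Cor5.3(ii)/(iv)). ([IUTchI] Cor 5.6 (i) p.154) [claim: Mochizuki2012, status: disputed] -/
theorem cor56iKit_of_laws (h53ii : FK.IsomFtoDBijective) (h53iv : FK.AutTemperedBijective)
    (hgood : ∀ v, v ∉ K.bad → (FK.thToF v).FullyFaithful)
    (hfaith : ∀ (R₁ R₂ : FK.RlfAmb) (a b : R₁ ≅ R₂),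
      (∀ v, (FK.rlfFm v).map a.hom = (FK.rlfFm v).map b.hom) → a = b)
    (canon : ∀ H : FK.ThetaHT, H.rlf ≅ FK.rlfOf fun v => (FK.thToF v).obj (H.th v))
    (hcanon : ∀ (H : FK.ThetaHT) (v : K.V),
      (FK.rlfFm v).map (canon H).hom ≫ (FK.rlfFm_rlfOf (fun w => (FK.thToF w).obj (H.th w)) v).hom =
        (H.rlf_fm v).hom)
    (hnat : ∀ (F₁ F₂ : ∀ v, FK.FAmb v) (f : ∀ v, F₁ v ≅ F₂ v) (v : K.V),
      (FK.rlfFm v).map (FK.rlfOfMap f).hom ≫ (FK.rlfFm_rlfOf F₂ v).hom =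
        (FK.rlfFm_rlfOf F₁ v).hom ≫ (FK.toFm v).map (f v).hom) :
    FK.Cor56iKit :=
  cor56iKit_of (thToFBijOnGood_of_fullyFaithful hgood) h53ii h53iv
    (rlfDetermined_of_laws hfaith canon hcanon hnat)

/-! ### Consistency: the laws hold for the toy kit -/

/-- The three structural laws are jointly satisfiable together with Cor 5.3 (ii), (iv): they hold for abc-iut-L5-t4's
toy kit `FKit.toy` (identity functors; global realified category = the product over `𝕍` with `rlfOf = id`,
`rlfOfMap = Pi.isoMk`, `rlfFm_rlfOf = Iso.refl`; canonical identification := the family `rlf_fm` itself), and the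
checklist then yields `Cor56iKit` for the toy kit (cf. `cor56iKit_toy`). PROVED.
([IUTchI] Cor 5.6 (i) p.154) [claim: Mochizuki2012, status: disputed] -/
theorem cor56iKit_toy_of_laws (l : ℕ) [Fact l.Prime] (hl : l ≠ 2) : (FKit.toy l hl).Cor56iKit := by
  refine cor56iKit_of_laws (isomFtoDBijective_toy l hl) (FKit.autTemperedBijective_toy l hl)
    (fun v _ => Functor.FullyFaithful.id _) (fun R₁ R₂ a b h => Iso.ext (funext fun v => h v))
    (fun H => Pi.isoMk fun v => H.rlf_fm v) (fun H v => ?_) (fun F₁ F₂ f v => ?_)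
  · show (H.rlf_fm v).hom ≫ 𝟙 _ = (H.rlf_fm v).hom
    exact Category.comp_id _
  · show (f v).hom ≫ 𝟙 _ = 𝟙 _ ≫ (f v).hom
    rw [Category.comp_id, Category.id_comp]

end

end FKit

end PMBaseKit

end Literature.IUT.HodgeTheaters
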